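import Summits.AtomisticToContinuum.HydrodynamicLimit.Theorems.JaynesSqueezeBlockGibbsMeasurableProfiles
import Summits.AtomisticToContinuum.HydrodynamicLimit.Theorems.JaynesSqueezeHardSphereLDAMeanLimit
import HarnessLib

/-!
# Hard-sphere local density approximation, X: the position marginal of the local Gibbs law

Helper file for the support item `HardSphereLDA` (stmt-AtomisticToContinuum-13459) of route
`JaynesSqueeze`: the bridge from the item's local Gibbs LAWS `localGibbsLaw σ a u θ N Φ` (phase
space, through a flow) with merely MEASURABLE profiles (`0 < a ≤ A`, `0 < θ`) to the configurational
canonical Gibbs ensemble of the other files. Measurability, the position/velocity disintegration,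
`canonicalPartition = posPartition` and the probability normalisation (clause (B2) of the item) are the
tree's `BlockGibbsLine.*'` lemmas (`JaynesSqueezeBlockGibbsMeasurableProfiles`); new here (for `0 ≤ a`,
any `σ`, with Mathlib's `0⁻¹ = 0` conventions when `Z = 0`):

* `map_positions_localGibbsLaw` — the position marginal of the law is `posGibbsMeasure a ε (N+1)`;
* `integral_empiricalDensityField_localGibbsLaw` — the mean empirical density under the law is the
  canonical Gibbs mean `Z⁻¹ ∫ 𝟙 ∏ a(xᵢ) (N+1)⁻¹ ∑ χ(xᵢ) dx` (clause (B3) reduces to file VIII).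

No definitions. prover-pitem-stmt-AtomisticToContinuum-13459-0.
-/

noncomputable section

namespace Summit.AtomisticToContinuum.HydrodynamicLimit.Theorems.HardSphereLDA

open MeasureTheory Filter Set Topology
open scoped ENNReal
open Literature.MathematicalPhysics.KineticTheory Literature.Analysis.FluidPDE
open Summit.AtomisticToContinuum.HydrodynamicLimit.Theorems.BlockGibbsLine

variable {a₀ θ₀ : T3 → ℝ} {u₀ : T3 → V3}

/-- **The position marginal of the local Gibbs law is the configurational Gibbs measure**
(`0 ≤ a`, `0 < θ` measurable, `u` measurable; any `σ`, `N` and flow `Φ`):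
`(z ↦ (xᵢ)ᵢ)_* law = Z_pos⁻¹ 𝟙_{no overlap} ∏ a(xᵢ) dx`. [folklore] -/
theorem map_positions_localGibbsLaw (ha : Measurable a₀) (hθ : Measurable θ₀) (hu : Measurable u₀)
    (ha0 : ∀ x, 0 ≤ a₀ x) (hθ0 : ∀ x, 0 < θ₀ x) (σ : ℝ) (N : ℕ)
    (Φ : HardSphereFlow (Torus.geometry (Fin 3)) (hsDiameter σ N) (N + 1)) :
    (localGibbsLaw σ a₀ u₀ θ₀ N Φ).map (fun z i => (z i).1) = posGibbsMeasure a₀ (hsDiameter σ N) (N + 1) := by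
  have hZeq := canonicalPartition_eq_posPartition' (u₀ := u₀) ha hθ hu ha0 hθ0 (hsDiameter σ N) (N + 1)
  have hposm : Measurable (fun z : Config (N + 1) (Fin 3) T3 => fun i => (z i).1) :=
    measurable_pi_lambda _ fun i => (measurable_pi_apply i).fst
  ext S hS
  rw [Measure.map_apply hposm hS, ← lintegral_indicator_one (hposm hS), localGibbsLaw_eq,
    lintegral_localGibbsMeasure' ha hθ hu ha0 hθ0 σ N (measurable_one.indicator (hposm hS)),
    posGibbsMeasure, withDensity_apply _ hS, ← lintegral_indicator hS, hZeq]
  refine lintegral_congr fun x => ?_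
  have hind : ∀ v : Fin (N + 1) → V3,
      ((fun z : Config (N + 1) (Fin 3) T3 => fun i => (z i).1) ⁻¹' S).indicator
        (1 : Config (N + 1) (Fin 3) T3 → ℝ≥0∞) (zipConfig (x, v)) = S.indicator 1 x := by
    intro v
    by_cases hx : x ∈ S
    · rw [Set.indicator_of_mem hx, Set.indicator_of_mem (show zipConfig (x, v) ∈ _ from hx)]
      rfl
    · rw [Set.indicator_of_notMem hx, Set.indicator_of_notMem (show zipConfig (x, v) ∉ _ from hx)]
  simp_rw [hind, lintegral_const, measure_univ, mul_one]
  by_cases hx : x ∈ S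
  · simp [hx]
  · simp [hx]

/-- **The mean empirical density under the local Gibbs law is its canonical Gibbs mean** (measurable
profiles `0 ≤ a`, `0 < θ`; any `σ`, `N`, flow): `∫ ⟨emp z, χ⟩ dlaw = Z⁻¹ ∫ 𝟙 ∏a · (N+1)⁻¹ ∑ χ(xᵢ) dx`.
[folklore] -/
theorem integral_empiricalDensityField_localGibbsLaw (ha : Measurable a₀) (hθ : Measurable θ₀)
    (hu : Measurable u₀) (ha0 : ∀ x, 0 ≤ a₀ x) (hθ0 : ∀ x, 0 < θ₀ x)
    (σ : ℝ) (N : ℕ) (Φ : HardSphereFlow (Torus.geometry (Fin 3)) (hsDiameter σ N) (N + 1))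
    {χ : T3 → ℝ} (hχ : Measurable χ) :
    ∫ z, empiricalDensityField z χ ∂localGibbsLaw σ a₀ u₀ θ₀ N Φ =
      (posPartition a₀ (hsDiameter σ N) (N + 1))⁻¹ *
        ∫ x, posWeight a₀ (hsDiameter σ N) (N + 1) x * (((N + 1 : ℕ) : ℝ)⁻¹ * ∑ i, χ (x i)) := by
  have hposm : Measurable (fun z : Config (N + 1) (Fin 3) T3 => fun i => (z i).1) :=
    measurable_pi_lambda _ fun i => (measurable_pi_apply i).fst
  have hfm : Measurable fun x : Fin (N + 1) → T3 => (((N + 1 : ℕ) : ℝ))⁻¹ * ∑ i, χ (x i) :=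
    measurable_const.mul (measurable_sum_apply hχ)
  have h2 : ∫ z, empiricalDensityField z χ ∂localGibbsLaw σ a₀ u₀ θ₀ N Φ =
      ∫ x, (((N + 1 : ℕ) : ℝ))⁻¹ * ∑ i, χ (x i) ∂(localGibbsLaw σ a₀ u₀ θ₀ N Φ).map (fun z i => (z i).1) := by
    rw [integral_map hposm.aemeasurable hfm.aestronglyMeasurable]
    refine integral_congr_ae (Eventually.of_forall fun z => ?_)
    dsimp only
    rw [empiricalDensityField_eq_sum]
  rw [h2, map_positions_localGibbsLaw ha hθ hu ha0 hθ0 σ N Φ, integral_posGibbsMeasure ha ha0]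

end Summit.AtomisticToContinuum.HydrodynamicLimit.Theorems.HardSphereLDA

end
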